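import Literature.Topology.FourManifolds.K1Loop
import Literature.Topology.FourManifolds.RouteMonotone
import HarnessLib

/-!
# The finger knot `K₁`, II: a fingertip with a controlled radial descent

Topic `Literature/Topology/FourManifolds`; fact seat `provefact-IsStrictHandleSlide.isSurgery`
(R. C. Kirby, *The Topology of 4-Manifolds*, LNM 1374 (1989), Ch. I §4, Fig. 4.2; remaining content:
the named fact (S) `Literature.Topology.FourManifolds.FramedLink.IsStrictHandleSlide.slideModel`).
`K1Loop.lean` realises any smooth height profile `x₀ = ρ h` over the left edge of the band as the
end of an ambient isotopy (the finger move) and proposed the loop profile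
`K1LoopData.rho` (rise – constant-radius arc – rise). For a twist of either sign the fingertip
must leave each tip with a *definite* radial descent before it flattens (`FingerMonotone.lean`);
this file builds such a profile **radius first**: with `r_lo h = 1 + (1 - ρ_lo h) e h` the slice
radius of the lower rise,

* `B h = (1 - T h) r_lo h + T h r_m h` blends, on `[h_D, h_D + β]`, the plunging `r_lo` into the
  gentle line `r_m h = r_D - s_max β - λ (h - h_D)` lying *below* `r_lo` on the blend zone (so
  `T' (r_m - r_lo) ≤ 0` and `B' ≤ -λ`);
* `rsl h = 2 r_low - smoothMinConst r_low ε_f (2 r_low - B h)` clamps `B` from below at the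
  constant radius `r_low > 1` (a smooth maximum), and symmetrically `rsu` from the upper tip;
* `rstar = rsl + rsu - r_low` (at every height one of the two is clamped), and the profile is
  `rho2 h = 1 - (rstar h - 1) / e h` (heights squashed into the window), so that the slice radius
  of the fingertip **is** `rstar`, and `rho2 = ρ_lo` exactly where `rstar = r_lo`.

Results: `K1Loop2Data` (the data and the design inequalities), `rho2` is `C^∞` with values in
`[0, 1]`, equal to the rises below / above the tips (`rho2_of_le_hD`, `rho2_of_ge_hDu`), hence
vanishing near the ends of the window (so `BandCore.exists_ambientIsotopy_heightGraph` applies);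
and the radial facts of the lower fingertip half used by `FingerHyp`: `rstar = rsl` below the
upper clamp height, `rsl ∈ [r_low, r_D]`, `rsl' ≤ 0`, `rsl' ≤ -λ` on `[h_D, h_g]`,
`rsl' ≥ -(1 + C_T) λ` beyond the blend zone.

## References

* R. C. Kirby, *The Topology of 4-Manifolds*, LNM 1374, Springer (1989), Ch. I §4. [Kirby1989]
-/

open scoped Topology ContDiff
open Set Real Filter

noncomputable section

namespace Literature.Topology.FourManifolds

/-- **Data of the finger knot with controlled descent** (extends `K1LoopData`; the fields `rlow`,
`β` of the parent are the clamp radius and the blend width). [cite: Kirby1989, Ch. I §4] -/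
structure K1Loop2Data extends K1LoopData where
  emin : ℝ
  emax : ℝ
  Me : ℝ
  Mρ : ℝ
  CT : ℝ
  lam : ℝ
  εf : ℝ
  hg : ℝ
  hgu : ℝ
  /-- The tips lie in the open height window where the squash is the identity. -/
  lo_win : 0.15 < dl.Hh dl.tD
  up_win : 1 - du.Hh du.tD < 0.85
  e_ge : ∀ h ∈ Icc (0.12 : ℝ) 0.88, emin ≤ e h
  e_le : ∀ h ∈ Icc (0.12 : ℝ) 0.88, e h ≤ emax
  emin_pos : 0 < emin
  e_deriv : ∀ h ∈ Ioo (0.15 : ℝ) 0.85, |deriv e h| ≤ Me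
  Mρ_pos : 0 < Mρ
  ρt_deriv_le : ∀ h, deriv dl.ρt h ≤ Mρ
  ρt_deriv_le' : ∀ h, deriv du.ρt h ≤ Mρ
  CT_ge : ∀ x, deriv smoothTransition x ≤ CT
  CT_nonneg : 0 ≤ CT
  lam_pos : 0 < lam
  εf_pos : 0 < εf
  /-- The blend zones are short: the rises are still un-saturated and steep there. -/
  β_le : β ≤ dl.κD / (2 * Mρ)
  β_le' : β ≤ du.κD / (2 * Mρ)
  /-- The gentle slope is below the plunge rate of the rises. -/
  lam_le : lam + dl.κD * Me ≤ dl.vmin * emin / dl.MH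
  lam_le' : lam + du.κD * Me ≤ du.vmin * emin / du.MH
  /-- The tip depths are small against the variation of `e`. -/
  κD_e : dl.κD * emax ≤ emin
  κD_e' : du.κD * emax ≤ emin
  /-- The robust-descent zones contain the blend zones. -/
  hg_ge : dl.Hh dl.tD + β ≤ hg
  hgu_le : hgu ≤ 1 - du.Hh du.tD - β
  /-- The clamp is inactive up to the ends of the robust-descent zones ... -/
  clamp_lo : rlow + εf ≤ 1 + dl.κD * e (dl.Hh dl.tD) - (Mρ * emax + Me) * β - lam * (hg - dl.Hh dl.tD)
  clamp_up : rlow + εf ≤ 1 + du.κD * e (1 - du.Hh du.tD) - (Mρ * emax + Me) * β - lam * (1 - du.Hh du.tD - β - hgu + β)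
  /-- ... and below the tips. -/
  clamp_base : rlow + εf ≤ 1 + dl.κD * emin
  clamp_base' : rlow + εf ≤ 1 + du.κD * emin
  /-- The two clamps meet: the lower blend is clamped before the upper one un-clamps. -/
  meet : dl.Hh dl.tD + (1 + dl.κD * e (dl.Hh dl.tD) - (Mρ * emax + Me) * β - rlow) / lam ≤
    1 - du.Hh du.tD - (1 + du.κD * e (1 - du.Hh du.tD) - (Mρ * emax + Me) * β - rlow) / lam

namespace K1Loop2Data

variable (L : K1Loop2Data)

/-! ### The profile -/

/-- The edge rate with heights squashed into the window. [folklore] -/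
def es (h : ℝ) : ℝ := L.e (heightSquash h)

/-- The slice radius of the lower rise, `1 + (1 - ρ_lo) e`. [folklore] -/
def rlo (h : ℝ) : ℝ := 1 + (1 - L.ρlo h) * L.es h

/-- The slice radius of the upper rise. [folklore] -/
def rup (h : ℝ) : ℝ := 1 + (1 - L.ρup h) * L.es h

/-- The lower tip radius `r_D = 1 + κ_D e (h_D)`. [folklore] -/
def rD : ℝ := 1 + L.dl.κD * L.e L.hD

/-- The upper tip radius. [folklore] -/
def rDu : ℝ := 1 + L.du.κD * L.e L.hDu

/-- The bound `s_max = Mρ e₊ + Me` of the plunge rate of the rises. [folklore] -/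
def smax : ℝ := L.Mρ * L.emax + L.Me

/-- The lower gentle line `r_m h = r_D - s_max β - λ (h - h_D)`. [folklore] -/
def rm (h : ℝ) : ℝ := L.rD - L.smax * L.β - L.lam * (h - L.hD)

/-- The upper gentle line (mirrored). [folklore] -/
def rmu (h : ℝ) : ℝ := L.rDu - L.smax * L.β - L.lam * (L.hDu - h)

/-- The lower blend `B = (1 - T) r_lo + T r_m`. [folklore] -/
def Bl (h : ℝ) : ℝ := (1 - L.T h) * L.rlo h + L.T h * L.rm h

/-- The upper blend `Bᵘ = Tu rup + (1 - Tu) r_mᵘ` (`Tu = 1` above `h_Dᵘ`). [folklore] -/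
def Bu (h : ℝ) : ℝ := L.Tu h * L.rup h + (1 - L.Tu h) * L.rmu h

/-- **The smooth clamp from below at `r_low`** (a smooth maximum with the constant):
`cl x = 2 r_low - smoothMinConst r_low ε_f (2 r_low - x)`. [folklore] -/
def cl (x : ℝ) : ℝ := 2 * L.rlow - smoothMinConst L.rlow L.εf (2 * L.rlow - x)

/-- The clamped lower blend. [folklore] -/
def rsl (h : ℝ) : ℝ := L.cl (L.Bl h)

/-- The clamped upper blend. [folklore] -/
def rsu (h : ℝ) : ℝ := L.cl (L.Bu h)

/-- **The slice radius of the fingertip**, `rsl + rsu - r_low`. [folklore] -/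
def rstar (h : ℝ) : ℝ := L.rsl h + L.rsu h - L.rlow

/-- **The height profile with controlled descent**, `1 - (rstar - 1)/e`. [cite: Kirby1989, Ch. I §4] -/
def rho2 (h : ℝ) : ℝ := 1 - (L.rstar h - 1) / L.es h

/-- The lower clamp height: from here on `B ≤ r_low`. [folklore] -/
def hcl : ℝ := L.hD + (L.rD - L.smax * L.β - L.rlow) / L.lam

/-- The upper clamp height: up to here `Bᵘ ≤ r_low`. [folklore] -/
def hclu : ℝ := L.hDu - (L.rDu - L.smax * L.β - L.rlow) / L.lam

/-! ### The clamp -/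

/-- `cl_of_ge` (auxiliary). [folklore] -/
theorem cl_of_ge {x : ℝ} (hx : L.rlow + L.εf ≤ x) : L.cl x = x := by
  rw [cl, smoothMinConst_of_le L.εf_pos (by linarith)]; ring

/-- `cl_of_le` (auxiliary). [folklore] -/
theorem cl_of_le {x : ℝ} (hx : x ≤ L.rlow) : L.cl x = L.rlow := by
  rw [cl, smoothMinConst_of_ge L.εf_pos (by linarith)]; ring

/-- `rlow_le_cl` (auxiliary). [folklore] -/
theorem rlow_le_cl (x : ℝ) : L.rlow ≤ L.cl x := by
  rw [cl]
  rcases le_total (2 * L.rlow - x) L.rlow with h1 | h1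
  · have := smoothMinConst_le (ε := L.εf) h1; linarith
  · rw [smoothMinConst_of_ge L.εf_pos h1]; linarith

/-- `cl_le_max` (auxiliary). [folklore] -/
theorem cl_le_max (x : ℝ) : L.cl x ≤ max x L.rlow := by
  rw [cl]
  rcases le_total (2 * L.rlow - x) L.rlow with h1 | h1
  · have h := (smoothMinConst_mem L.rlow L.εf (2 * L.rlow - x)).1
    rw [min_eq_left h1] at h
    exact le_trans (by linarith) (le_max_left _ _)
  · rw [smoothMinConst_of_ge L.εf_pos h1]
    exact le_trans (by linarith) (le_max_right _ _)

/-- `contDiff_cl` (auxiliary). [folklore] -/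
theorem contDiff_cl : ContDiff ℝ ∞ L.cl :=
  contDiff_const.sub ((contDiff_smoothMinConst _ _).comp (contDiff_const.sub contDiff_id))

/-- The derivative of the clamp: `cl' x = m' (2 r_low - x)`, `m = smoothMinConst r_low ε_f`. [folklore] -/
theorem hasDerivAt_cl (x : ℝ) :
    HasDerivAt L.cl ((1 - smoothStep (L.rlow - L.εf) L.rlow (2 * L.rlow - x)) +
      (L.rlow - (2 * L.rlow - x)) * deriv (smoothStep (L.rlow - L.εf) L.rlow) (2 * L.rlow - x)) x := by
  have hm := hasDerivAt_smoothMinConst L.rlow L.εf (2 * L.rlow - x)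
  have hi : HasDerivAt (fun x : ℝ ↦ 2 * L.rlow - x) (0 - 1) x := (hasDerivAt_const x _).sub (hasDerivAt_id x)
  have h := (hasDerivAt_const x (2 * L.rlow)).sub (hm.comp x hi)
  refine h.congr_deriv ?_
  ring

/-- The clamp derivative lies in `[0, 1 + C_T]`. [folklore] -/
theorem deriv_cl_mem (x : ℝ) : deriv L.cl x ∈ Icc (0 : ℝ) (1 + L.CT) := by
  rw [(L.hasDerivAt_cl x).deriv]
  set u := 2 * L.rlow - x with hu
  have hS := smoothStep_mem_Icc (L.rlow - L.εf) L.rlow u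
  have hlt : L.rlow - L.εf < L.rlow := by linarith [L.εf_pos]
  have hS' := deriv_smoothStep_nonneg hlt u
  rcases le_or_gt u L.rlow with h1 | h1
  · -- below the clamp level
    refine ⟨by nlinarith [hS.2, mul_nonneg (sub_nonneg.2 h1) hS'], ?_⟩
    -- `(L - u) S' u ≤ CT`: `S' u = T' ((u - (L-ε))/ε)/ε` and `L - u ≤ ε` where `S' ≠ 0`
    have hb : (L.rlow - u) * deriv (smoothStep (L.rlow - L.εf) L.rlow) u ≤ L.CT := by
      rcases le_or_gt u (L.rlow - L.εf) with h2 | h2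
      · have : deriv (smoothStep (L.rlow - L.εf) L.rlow) u = 0 := by
          rcases h2.eq_or_lt with h3 | h3
          · rw [h3]; exact deriv_smoothStep_left _ _
          · exact deriv_smoothStep_of_lt hlt h3
        rw [this, mul_zero]; exact L.CT_nonneg
      · rw [(hasDerivAt_smoothStep (L.rlow - L.εf) L.rlow u).deriv]
        have hε : L.rlow - (L.rlow - L.εf) = L.εf := by ring
        rw [hε]
        have hT' := L.CT_ge ((u - (L.rlow - L.εf)) / L.εf)
        have hT0 : 0 ≤ deriv smoothTransition ((u - (L.rlow - L.εf)) / L.εf) :=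
          (((smoothTransition.contDiff (n := 1)).differentiable one_ne_zero) _).hasDerivAt.nonneg_of_monotone
            smoothTransition.monotone
        have hfac : (L.rlow - u) * (L.εf)⁻¹ ≤ 1 := by
          rw [mul_inv_le_iff₀ L.εf_pos]; linarith
        have hfac0 : 0 ≤ (L.rlow - u) * (L.εf)⁻¹ := mul_nonneg (by linarith) (inv_nonneg.2 L.εf_pos.le)
        calc (L.rlow - u) * (deriv smoothTransition ((u - (L.rlow - L.εf)) / L.εf) * (L.εf)⁻¹)
            = ((L.rlow - u) * (L.εf)⁻¹) * deriv smoothTransition ((u - (L.rlow - L.εf)) / L.εf) := by ring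
          _ ≤ 1 * L.CT := mul_le_mul hfac hT' hT0 zero_le_one
          _ = L.CT := one_mul _
    linarith [hS.1]
  · -- above the clamp level the step is constant `1`
    have hS1 : smoothStep (L.rlow - L.εf) L.rlow u = 1 := smoothStep_of_ge hlt h1.le
    have hS'0 : deriv (smoothStep (L.rlow - L.εf) L.rlow) u = 0 := deriv_smoothStep_of_gt hlt h1
    rw [hS1, hS'0]; constructor <;> nlinarith [L.CT_nonneg]

/-- Above `r_low + ε_f` the clamp has derivative `1`. [folklore] -/
theorem deriv_cl_of_ge {x : ℝ} (hx : L.rlow + L.εf ≤ x) : deriv L.cl x = 1 := by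
  rw [(L.hasDerivAt_cl x).deriv]
  have hlt : L.rlow - L.εf < L.rlow := by linarith [L.εf_pos]
  have hu : 2 * L.rlow - x ≤ L.rlow - L.εf := by linarith
  rw [smoothStep_of_le hlt hu]
  rcases hu.eq_or_lt with h | h
  · rw [h, deriv_smoothStep_left]; ring
  · rw [deriv_smoothStep_of_lt hlt h]; ring

/-! ### Smoothness -/

/-- `contDiff_es` (auxiliary). [folklore] -/
theorem contDiff_es : ContDiff ℝ ∞ L.es := L.contDiff_e_squash
/-- `es_pos` (auxiliary). [folklore] -/
theorem es_pos (h : ℝ) : 0 < L.es h := L.e_squash_pos h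
/-- `es_mem` (auxiliary). [folklore] -/
theorem es_mem (h : ℝ) : L.emin ≤ L.es h ∧ L.es h ≤ L.emax := ⟨L.e_ge _ (heightSquash_mem h), L.e_le _ (heightSquash_mem h)⟩

/-- `contDiff_rlo` (auxiliary). [folklore] -/
theorem contDiff_rlo : ContDiff ℝ ∞ L.rlo := contDiff_const.add ((contDiff_const.sub L.contDiff_ρlo).mul L.contDiff_es)
/-- `contDiff_rup` (auxiliary). [folklore] -/
theorem contDiff_rup : ContDiff ℝ ∞ L.rup := contDiff_const.add ((contDiff_const.sub L.contDiff_ρup).mul L.contDiff_es)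
/-- `contDiff_rm` (auxiliary). [folklore] -/
theorem contDiff_rm : ContDiff ℝ ∞ L.rm := contDiff_const.sub (contDiff_const.mul (contDiff_id.sub contDiff_const))
/-- `contDiff_rmu` (auxiliary). [folklore] -/
theorem contDiff_rmu : ContDiff ℝ ∞ L.rmu := contDiff_const.sub (contDiff_const.mul (contDiff_const.sub contDiff_id))
/-- `contDiff_Bl` (auxiliary). [folklore] -/
theorem contDiff_Bl : ContDiff ℝ ∞ L.Bl :=
  ((contDiff_const.sub L.contDiff_T).mul L.contDiff_rlo).add (L.contDiff_T.mul L.contDiff_rm)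
/-- `contDiff_Bu` (auxiliary). [folklore] -/
theorem contDiff_Bu : ContDiff ℝ ∞ L.Bu :=
  (L.contDiff_Tu.mul L.contDiff_rup).add ((contDiff_const.sub L.contDiff_Tu).mul L.contDiff_rmu)
/-- `contDiff_rsl` (auxiliary). [folklore] -/
theorem contDiff_rsl : ContDiff ℝ ∞ L.rsl := L.contDiff_cl.comp L.contDiff_Bl
/-- `contDiff_rsu` (auxiliary). [folklore] -/
theorem contDiff_rsu : ContDiff ℝ ∞ L.rsu := L.contDiff_cl.comp L.contDiff_Bu
/-- `contDiff_rstar` (auxiliary). [folklore] -/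
theorem contDiff_rstar : ContDiff ℝ ∞ L.rstar := (L.contDiff_rsl.add L.contDiff_rsu).sub contDiff_const

/-- **The profile is `C^∞`.** [folklore] -/
theorem contDiff_rho2 : ContDiff ℝ ∞ L.rho2 :=
  contDiff_const.sub ((L.contDiff_rstar.sub contDiff_const).div L.contDiff_es fun h ↦ (L.es_pos h).ne')

/-! ### Elementary inequalities between the constants -/

/-- `emin_le_emax` (auxiliary). [folklore] -/
theorem emin_le_emax : L.emin ≤ L.emax := (L.es_mem 0).1.trans (L.es_mem 0).2
/-- `emax_pos` (auxiliary). [folklore] -/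
theorem emax_pos : 0 < L.emax := L.emin_pos.trans_le L.emin_le_emax
/-- `Me_nonneg` (auxiliary). [folklore] -/
theorem Me_nonneg : 0 ≤ L.Me := (abs_nonneg _).trans (L.e_deriv 2⁻¹ ⟨by norm_num, by norm_num⟩)
/-- `smax_pos` (auxiliary). [folklore] -/
theorem smax_pos : 0 < L.smax := by rw [smax]; nlinarith [L.Mρ_pos, L.emax_pos, L.Me_nonneg]
/-- `κD_le_one` (auxiliary). [folklore] -/
theorem κD_le_one : L.dl.κD ≤ 1 := by
  have h := L.κD_e; have := L.emin_le_emax; have := L.dl.κD_pos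
  by_contra hc; nlinarith [lt_of_not_ge hc, L.emin_pos]
/-- `κD_le_one'` (auxiliary). [folklore] -/
theorem κD_le_one' : L.du.κD ≤ 1 := by
  have h := L.κD_e'; have := L.emin_le_emax; have := L.du.κD_pos
  by_contra hc; nlinarith [lt_of_not_ge hc, L.emin_pos]

/-- `hD_mem_win` (auxiliary). [folklore] -/
theorem hD_mem_win : L.hD ∈ Ioo (0.15 : ℝ) 0.85 := by
  have h1 := L.hD_lt_hDu; have h2 := L.up_win; have h3 := L.lo_win
  simp only [K1LoopData.hD, K1LoopData.hDu] at *
  exact ⟨h3, by linarith⟩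
/-- `hDu_mem_win` (auxiliary). [folklore] -/
theorem hDu_mem_win : L.hDu ∈ Ioo (0.15 : ℝ) 0.85 := by
  have h1 := L.hD_lt_hDu; have h2 := L.up_win; have h3 := L.lo_win
  simp only [K1LoopData.hD, K1LoopData.hDu] at *
  exact ⟨by linarith, h2⟩

/-- `es_of_mem` (auxiliary). [folklore] -/
theorem es_of_mem {h : ℝ} (hh : h ∈ Icc (0.15 : ℝ) 0.85) : L.es h = L.e h := by rw [es, heightSquash_of_mem hh]

/-- `rD_eq` (auxiliary). [folklore] -/
theorem rD_eq : L.rD = 1 + L.dl.κD * L.es L.hD := by rw [rD, L.es_of_mem (Ioo_subset_Icc_self L.hD_mem_win)]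
/-- `rDu_eq` (auxiliary). [folklore] -/
theorem rDu_eq : L.rDu = 1 + L.du.κD * L.es L.hDu := by rw [rDu, L.es_of_mem (Ioo_subset_Icc_self L.hDu_mem_win)]

/-- `rlow_add_le_rD` (auxiliary). [folklore] -/
theorem rlow_add_le_rD : L.rlow + L.εf ≤ L.rD := by
  have h := L.clamp_lo; have hg := L.hg_ge
  simp only [rD, K1LoopData.hD]
  have hβ := L.β_pos
  nlinarith [L.smax_pos, L.lam_pos, mul_nonneg L.lam_pos.le (by linarith : (0:ℝ) ≤ L.hg - L.dl.Hh L.dl.tD),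
    mul_nonneg (show (0:ℝ) ≤ L.Mρ * L.emax + L.Me by nlinarith [L.Mρ_pos, L.emax_pos, L.Me_nonneg]) L.β_pos.le]

/-- `rlow_add_le_rDu` (auxiliary). [folklore] -/
theorem rlow_add_le_rDu : L.rlow + L.εf ≤ L.rDu := by
  have h := L.clamp_up; have hg := L.hgu_le
  simp only [rDu, K1LoopData.hDu]
  have hβ := L.β_pos
  nlinarith [L.smax_pos, L.lam_pos, mul_nonneg L.lam_pos.le (by linarith : (0:ℝ) ≤ 1 - L.du.Hh L.du.tD - L.β - L.hgu + L.β),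
    mul_nonneg (show (0:ℝ) ≤ L.Mρ * L.emax + L.Me by nlinarith [L.Mρ_pos, L.emax_pos, L.Me_nonneg]) L.β_pos.le]

/-! ### The rises near the tips -/

/-- The lower rise profile is monotone. [folklore] -/
theorem monotone_ρlo : Monotone L.ρlo := by
  intro x y hxy
  simp only [K1LoopData.ρlo, K2LiteData.ρ₁]
  -- `smoothMinConst 1 εℓ` is monotone on `ℝ`
  have hm : Monotone (smoothMinConst 1 L.dl.εℓ) := by
    refine monotone_of_deriv_nonneg ((contDiff_smoothMinConst _ _).differentiable (by simp)) fun u ↦ ?_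
    rcases le_or_gt u 1 with hu | hu
    · exact deriv_smoothMinConst_nonneg L.dl.εℓ_pos hu
    · rw [(hasDerivAt_smoothMinConst 1 L.dl.εℓ u).deriv, smoothStep_of_ge (by linarith [L.dl.εℓ_pos]) hu.le,
        deriv_smoothStep_of_gt (by linarith [L.dl.εℓ_pos]) hu]
      simp
  exact hm (L.dl.monotone_ρt hxy)

/-- The upper rise profile is antitone (reflected heights). [folklore] -/
theorem antitone_ρup : Antitone L.ρup := by
  intro x y hxy
  simp only [K1LoopData.ρup, K2LiteData.ρ₁]
  have hm : Monotone (smoothMinConst 1 L.du.εℓ) := by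
    refine monotone_of_deriv_nonneg ((contDiff_smoothMinConst _ _).differentiable (by simp)) fun u ↦ ?_
    rcases le_or_gt u 1 with hu | hu
    · exact deriv_smoothMinConst_nonneg L.du.εℓ_pos hu
    · rw [(hasDerivAt_smoothMinConst 1 L.du.εℓ u).deriv, smoothStep_of_ge (by linarith [L.du.εℓ_pos]) hu.le,
        deriv_smoothStep_of_gt (by linarith [L.du.εℓ_pos]) hu]
      simp
  exact hm (L.du.monotone_ρt (by linarith))

/-- At the lower tip height the rise profile is `x_D`. [folklore] -/
theorem ρlo_hD : L.ρlo L.hD = L.dl.xD := by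
  simp only [K1LoopData.ρlo, K2LiteData.ρ₁, K1LoopData.hD]
  rw [L.dl.ρt_Hh_tD, smoothMinConst_of_le L.dl.εℓ_pos (by rw [K2LiteData.xD]; linarith [L.dl.εℓ_lt_κD])]

/-- `ρup_hDu` (auxiliary). [folklore] -/
theorem ρup_hDu : L.ρup L.hDu = L.du.xD := by
  simp only [K1LoopData.ρup, K2LiteData.ρ₁, K1LoopData.hDu, sub_sub_cancel]
  rw [L.du.ρt_Hh_tD, smoothMinConst_of_le L.du.εℓ_pos (by rw [K2LiteData.xD]; linarith [L.du.εℓ_lt_κD])]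

/-- Below the lower tip, `1 - ρ_lo ≥ κ_D`, so `r_lo ≥ 1 + κ_D e₋`. [folklore] -/
theorem rlo_ge_of_le_hD {h : ℝ} (hh : h ≤ L.hD) : 1 + L.dl.κD * L.emin ≤ L.rlo h := by
  have h1 : L.ρlo h ≤ L.dl.xD := L.ρlo_hD ▸ L.monotone_ρlo hh
  have h2 := (L.es_mem h).1
  rw [rlo]; rw [K2LiteData.xD] at h1
  nlinarith [L.dl.κD_pos, L.emin_pos, (L.ρlo_mem h).1]

/-- `rup_ge_of_hDu_le` (auxiliary). [folklore] -/
theorem rup_ge_of_hDu_le {h : ℝ} (hh : L.hDu ≤ h) : 1 + L.du.κD * L.emin ≤ L.rup h := by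
  have h1 : L.ρup h ≤ L.du.xD := L.ρup_hDu ▸ L.antitone_ρup hh
  have h2 := (L.es_mem h).1
  rw [rup]; rw [K2LiteData.xD] at h1
  nlinarith [L.du.κD_pos, L.emin_pos, (L.ρup_mem h).1]

/-- `rlo_hD` (auxiliary). [folklore] -/
theorem rlo_hD : L.rlo L.hD = L.rD := by rw [rlo, L.ρlo_hD, L.rD_eq, K2LiteData.xD]; ring
/-- `rup_hDu` (auxiliary). [folklore] -/
theorem rup_hDu : L.rup L.hDu = L.rDu := by rw [rup, L.ρup_hDu, L.rDu_eq, K2LiteData.xD]; ring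

/-! ### The regions of the profile -/

/-- `Bl_of_le_hD` (auxiliary). [folklore] -/
theorem Bl_of_le_hD {h : ℝ} (hh : h ≤ L.hD) : L.Bl h = L.rlo h := by
  rw [Bl, K1LoopData.T, smoothStep_of_le L.T_lt hh]; ring

/-- `Bl_of_ge` (auxiliary). [folklore] -/
theorem Bl_of_ge {h : ℝ} (hh : L.hD + L.β ≤ h) : L.Bl h = L.rm h := by
  rw [Bl, L.T_of_ge hh]; ring

/-- `Bu_of_ge_hDu` (auxiliary). [folklore] -/
theorem Bu_of_ge_hDu {h : ℝ} (hh : L.hDu ≤ h) : L.Bu h = L.rup h := by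
  rw [Bu, L.Tu_of_ge hh]; ring

/-- `Bu_of_le` (auxiliary). [folklore] -/
theorem Bu_of_le {h : ℝ} (hh : h ≤ L.hDu - L.β) : L.Bu h = L.rmu h := by
  rw [Bu, L.Tu_of_le hh]; ring

/-- Below the lower tip the clamp is inactive on `B = r_lo`. [folklore] -/
theorem rsl_of_le_hD {h : ℝ} (hh : h ≤ L.hD) : L.rsl h = L.rlo h := by
  rw [rsl, L.Bl_of_le_hD hh, L.cl_of_ge (L.clamp_base.trans (L.rlo_ge_of_le_hD hh))]

/-- `rsu_of_ge_hDu` (auxiliary). [folklore] -/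
theorem rsu_of_ge_hDu {h : ℝ} (hh : L.hDu ≤ h) : L.rsu h = L.rup h := by
  rw [rsu, L.Bu_of_ge_hDu hh, L.cl_of_ge (L.clamp_base'.trans (L.rup_ge_of_hDu_le hh))]

/-- Beyond the lower clamp height the lower blend is clamped: `rsl = r_low`. [folklore] -/
theorem rsl_of_ge_hcl {h : ℝ} (hh : L.hcl ≤ h) : L.rsl h = L.rlow := by
  have hβ : L.hD + L.β ≤ h := by
    -- `hcl ≥ hD + β` since `rm (hD + β) = rD - smax β - lam β ≥ rlow + εf > rlow`... we use `clamp_lo`, `hg_ge`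
    have h1 := L.clamp_lo; have h2 := L.hg_ge
    simp only [hcl, rD, K1LoopData.hD] at hh ⊢
    have hlam := L.lam_pos
    have : L.β ≤ (1 + L.dl.κD * L.e (L.dl.Hh L.dl.tD) - L.smax * L.β - L.rlow) / L.lam := by
      rw [le_div_iff₀ hlam]; simp only [smax]
      nlinarith [L.εf_pos, mul_le_mul_of_nonneg_left h2 hlam.le]
    linarith
  rw [rsl, L.Bl_of_ge hβ]
  apply L.cl_of_le
  simp only [rm]
  simp only [hcl] at hh
  have hlam := L.lam_pos
  have := (div_le_iff₀ hlam).1 (by linarith : (L.rD - L.smax * L.β - L.rlow) / L.lam ≤ h - L.hD)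
  linarith

/-- Before the upper clamp height the upper blend is clamped: `rsu = r_low`. [folklore] -/
theorem rsu_of_le_hclu {h : ℝ} (hh : h ≤ L.hclu) : L.rsu h = L.rlow := by
  have hβ : h ≤ L.hDu - L.β := by
    have h1 := L.clamp_up; have h2 := L.hgu_le
    simp only [hclu, rDu, K1LoopData.hDu] at hh ⊢
    have hlam := L.lam_pos
    have : L.β ≤ (1 + L.du.κD * L.e (1 - L.du.Hh L.du.tD) - L.smax * L.β - L.rlow) / L.lam := by
      rw [le_div_iff₀ hlam]; simp only [smax]
      nlinarith [L.εf_pos, mul_le_mul_of_nonneg_left h2 hlam.le]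
    linarith
  rw [rsu, L.Bu_of_le hβ]
  apply L.cl_of_le
  simp only [rmu]
  simp only [hclu] at hh
  have hlam := L.lam_pos
  have := (div_le_iff₀ hlam).1 (by linarith : (L.rDu - L.smax * L.β - L.rlow) / L.lam ≤ L.hDu - h)
  linarith

/-- `hcl_le_hclu` (auxiliary). [folklore] -/
theorem hcl_le_hclu : L.hcl ≤ L.hclu := by
  have := L.meet; simp only [hcl, hclu, rD, rDu, smax, K1LoopData.hD, K1LoopData.hDu] at this ⊢; exact this

/-- **Up to the upper clamp height the fingertip radius is the clamped lower blend.** [folklore] -/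
theorem rstar_of_le_hclu {h : ℝ} (hh : h ≤ L.hclu) : L.rstar h = L.rsl h := by
  rw [rstar, L.rsu_of_le_hclu hh]; ring

/-- From the lower clamp height on the fingertip radius is the clamped upper blend. [folklore] -/
theorem rstar_of_ge_hcl {h : ℝ} (hh : L.hcl ≤ h) : L.rstar h = L.rsu h := by
  rw [rstar, L.rsl_of_ge_hcl hh]; ring

/-- `rD_sub_pos` (auxiliary). [folklore] -/
theorem rD_sub_pos : 0 < L.rD - L.smax * L.β - L.rlow := by
  have h1 := L.clamp_lo; have h2 := L.hg_ge; have h3 := L.εf_pos; have h4 := L.lam_pos; have h5 := L.β_pos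
  simp only [rD, smax, K1LoopData.hD] at *
  nlinarith [mul_nonneg h4.le (by linarith : (0:ℝ) ≤ L.hg - L.dl.Hh L.dl.tD)]

/-- `rDu_sub_pos` (auxiliary). [folklore] -/
theorem rDu_sub_pos : 0 < L.rDu - L.smax * L.β - L.rlow := by
  have h1 := L.clamp_up; have h2 := L.hgu_le; have h3 := L.εf_pos; have h4 := L.lam_pos; have h5 := L.β_pos
  simp only [rDu, smax, K1LoopData.hDu] at *
  nlinarith [mul_nonneg h4.le (by linarith : (0:ℝ) ≤ 1 - L.du.Hh L.du.tD - L.β - L.hgu + L.β)]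

/-- `hD_lt_hcl` (auxiliary). [folklore] -/
theorem hD_lt_hcl : L.hD < L.hcl := by
  have := div_pos L.rD_sub_pos L.lam_pos
  rw [hcl]; linarith

/-- `hclu_lt_hDu` (auxiliary). [folklore] -/
theorem hclu_lt_hDu : L.hclu < L.hDu := by
  have := div_pos L.rDu_sub_pos L.lam_pos
  rw [hclu]; linarith

/-- **Below the lower tip the profile is the lower rise.** [folklore] -/
theorem rho2_of_le_hD {h : ℝ} (hh : h ≤ L.hD) : L.rho2 h = L.ρlo h := by
  have hst : L.rstar h = L.rlo h := by
    rw [L.rstar_of_le_hclu (hh.trans (L.hD_lt_hcl.le.trans L.hcl_le_hclu)), L.rsl_of_le_hD hh]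
  rw [rho2, hst, rlo]
  field_simp [(L.es_pos h).ne']
  ring

/-- **Above the upper tip the profile is the upper rise.** [folklore] -/
theorem rho2_of_ge_hDu {h : ℝ} (hh : L.hDu ≤ h) : L.rho2 h = L.ρup h := by
  have hst : L.rstar h = L.rup h := by
    rw [L.rstar_of_ge_hcl ((L.hcl_le_hclu.trans L.hclu_lt_hDu.le).trans hh), L.rsu_of_ge_hDu hh]
  rw [rho2, hst, rup]
  field_simp [(L.es_pos h).ne']
  ring

/-- Below the lower junction height the profile vanishes. [folklore] -/
theorem rho2_of_le_fa {h : ℝ} (hh : h ≤ L.dl.f L.dl.a) : L.rho2 h = 0 := by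
  rw [L.rho2_of_le_hD (hh.trans L.fa_lt_hD.le), K1LoopData.ρlo, L.dl.ρ₁_of_le_fa hh]

/-- Above the (reflected) upper junction height the profile vanishes. [folklore] -/
theorem rho2_of_ge_fa {h : ℝ} (hh : 1 - L.du.f L.du.a ≤ h) : L.rho2 h = 0 := by
  rw [L.rho2_of_ge_hDu (L.hDu_lt.le.trans hh), K1LoopData.ρup, L.du.ρ₁_of_le_fa (by linarith)]



/-! ### The lower rise near the tip: heights of the blend zone are track heights -/

/-- The level `Hh t_L` is at least `κ_D / Mρ` above the tip height. [folklore] -/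
theorem hD_add_le_Hh_tL : L.hD + L.dl.κD / L.Mρ ≤ L.dl.Hh L.dl.tL := by
  -- `κ_D = ρt (Hh t_L) - ρt (h_D) ≤ Mρ (Hh t_L - h_D)`
  have hmono : ∀ x y, x ≤ y → L.dl.ρt y - L.dl.ρt x ≤ L.Mρ * (y - x) := by
    intro x y hxy
    have hanti : AntitoneOn (fun u ↦ L.dl.ρt u - L.Mρ * u) (Icc x y) := by
      refine antitoneOn_of_deriv_nonpos (convex_Icc _ _)
        ((L.dl.contDiff_ρt.continuous.sub (continuous_const.mul continuous_id)).continuousOn)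
        (((L.dl.contDiff_ρt.differentiable (by simp)).sub ((differentiable_const _).mul differentiable_id)).differentiableOn)
        fun u _ ↦ ?_
      have hd : HasDerivAt (fun u ↦ L.dl.ρt u - L.Mρ * u) (deriv L.dl.ρt u - L.Mρ * 1) u :=
        ((L.dl.contDiff_ρt.differentiable (by simp) u).hasDerivAt).sub ((hasDerivAt_id u).const_mul _)
      rw [hd.deriv]; linarith [L.ρt_deriv_le u]
    have := hanti ⟨le_rfl, hxy⟩ ⟨hxy, le_rfl⟩ hxy
    simp only at this; linarith
  have hle : L.hD ≤ L.dl.Hh L.dl.tL := L.dl.Hh_le_Hh L.dl.tD_lt_tL.le (by linarith [L.dl.tL_mem.2, L.dl.ε_pos])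
  have h := hmono _ _ hle
  rw [K1LoopData.hD] at h ⊢
  have e1 : L.dl.ρt (L.dl.Hh L.dl.tL) = 1 := L.dl.Xl_tL
  have e2 : L.dl.ρt (L.dl.Hh L.dl.tD) = L.dl.xD := L.dl.Xl_tD
  rw [e1, e2, K2LiteData.xD] at h
  have hM := L.Mρ_pos
  have : L.dl.κD / L.Mρ ≤ L.dl.Hh L.dl.tL - L.dl.Hh L.dl.tD := by
    rw [div_le_iff₀ hM]; nlinarith
  linarith

/-- The blend zone `[h_D, h_D + β]` lies below the level `Hh t_L`. [folklore] -/
theorem zone_le_Hh_tL {h : ℝ} (hh : h ∈ Icc L.hD (L.hD + L.β)) : h ≤ L.dl.Hh L.dl.tL := by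
  have h1 := L.hD_add_le_Hh_tL; have h2 := L.β_le
  have h3 : L.dl.κD / (2 * L.Mρ) ≤ L.dl.κD / L.Mρ := by
    apply div_le_div_of_nonneg_left L.dl.κD_pos.le L.Mρ_pos; linarith [L.Mρ_pos]
  linarith [hh.2]

/-- **On the blend zone the rise profile has slope at least `vmin / MH`.** Every height there is a
track height `Hh τ`, `τ ∈ [t_D, t_L]`, where `Xl' = ρt' (Hh) · Hh' ≥ vmin` and `Hh' ≤ MH`. [folklore] -/
theorem deriv_ρt_ge {h : ℝ} (hh : h ∈ Icc L.hD (L.hD + L.β)) : L.dl.vmin / L.dl.MH ≤ deriv L.dl.ρt h := by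
  -- find `τ ∈ [t_D, t_L]` with `Hh τ = h`
  have hc : ContinuousOn L.dl.Hh (Icc L.dl.tD L.dl.tL) := L.dl.contDiff_Hh.continuous.continuousOn
  have hmem : h ∈ Icc (L.dl.Hh L.dl.tD) (L.dl.Hh L.dl.tL) := ⟨hh.1, L.zone_le_Hh_tL hh⟩
  obtain ⟨τ, hτ, hτh⟩ := intermediate_value_Icc L.dl.tD_lt_tL.le hc hmem
  have hX := L.dl.vmin_le_dXl hτ
  rw [(L.dl.hasDerivAt_Xl τ).deriv, hτh] at hX
  have hH := L.dl.deriv_Hh_le_MH ⟨(L.dl.I_sub hτ).1, L.dl.le_bε hτ⟩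
  have hH0 := L.dl.deriv_Hh_pos (t := τ) (L.dl.le_bε hτ)
  have hρ0 := L.dl.deriv_ρt_nonneg h
  rw [div_le_iff₀ L.dl.MH_pos]
  nlinarith [mul_le_mul_of_nonneg_left hH hρ0]

/-- On the blend zone `ρt ∈ [x_D, 1 - κ_D/2]` (un-saturated: `ρ_lo = ρt` there). [folklore] -/
theorem ρt_mem_zone {h : ℝ} (hh : h ∈ Icc L.hD (L.hD + L.β)) : L.dl.ρt h ∈ Icc L.dl.xD (1 - L.dl.κD / 2) := by
  have h1 : L.dl.xD ≤ L.dl.ρt h := by rw [← L.dl.ρt_Hh_tD]; exact L.dl.monotone_ρt hh.1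
  refine ⟨h1, ?_⟩
  -- `ρt h ≤ ρt hD + Mρ (h - hD) ≤ xD + Mρ β ≤ 1 - κD + κD/2`
  have hanti : AntitoneOn (fun u ↦ L.dl.ρt u - L.Mρ * u) (Icc L.hD h) := by
    refine antitoneOn_of_deriv_nonpos (convex_Icc _ _)
      ((L.dl.contDiff_ρt.continuous.sub (continuous_const.mul continuous_id)).continuousOn)
      (((L.dl.contDiff_ρt.differentiable (by simp)).sub ((differentiable_const _).mul differentiable_id)).differentiableOn)
      fun u _ ↦ ?_
    have hd : HasDerivAt (fun u ↦ L.dl.ρt u - L.Mρ * u) (deriv L.dl.ρt u - L.Mρ * 1) u :=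
      ((L.dl.contDiff_ρt.differentiable (by simp) u).hasDerivAt).sub ((hasDerivAt_id u).const_mul _)
    rw [hd.deriv]; linarith [L.ρt_deriv_le u]
  have := hanti ⟨le_rfl, hh.1⟩ ⟨hh.1, le_rfl⟩ hh.1
  simp only at this
  have e2 : L.dl.ρt L.hD = L.dl.xD := L.dl.Xl_tD
  have exD : L.dl.xD = 1 - L.dl.κD := rfl
  rw [e2, exD] at this
  have hβ := L.β_le
  have hM := L.Mρ_pos
  have : L.Mρ * (h - L.hD) ≤ L.dl.κD / 2 := by
    calc L.Mρ * (h - L.hD) ≤ L.Mρ * L.β := mul_le_mul_of_nonneg_left (by linarith [hh.2]) hM.le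
      _ ≤ L.Mρ * (L.dl.κD / (2 * L.Mρ)) := mul_le_mul_of_nonneg_left hβ hM.le
      _ = L.dl.κD / 2 := by field_simp
  linarith

/-- On the blend zone the rise is un-saturated: `ρ_lo = ρt` near every point. [folklore] -/
theorem ρlo_eventuallyEq {h : ℝ} (hh : h ∈ Icc L.hD (L.hD + L.β)) : L.ρlo =ᶠ[𝓝 h] L.dl.ρt := by
  have hlt : L.dl.ρt h < 1 - L.dl.εℓ := by
    have := (L.ρt_mem_zone hh).2; linarith [L.dl.εℓ_le, L.dl.κD_pos]
  have ho : IsOpen {u | L.dl.ρt u < 1 - L.dl.εℓ} := isOpen_lt L.dl.contDiff_ρt.continuous continuous_const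
  filter_upwards [ho.mem_nhds hlt] with u hu
  simp only [K1LoopData.ρlo, K2LiteData.ρ₁]
  exact smoothMinConst_of_le L.dl.εℓ_pos hu.le

/-- `zone_sub_win` (auxiliary). [folklore] -/
theorem zone_sub_win {h : ℝ} (hh : h ∈ Icc L.hD (L.hD + L.β)) : h ∈ Ioo (0.15 : ℝ) 0.85 := by
  have h1 := L.hD_mem_win; have h2 := L.hDu_mem_win; have h3 := L.sep
  simp only [K1LoopData.hD, K1LoopData.hDu] at *
  exact ⟨h1.1.trans_le hh.1, by linarith [hh.2, h2.2, L.β_pos]⟩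

/-- `es_eventuallyEq` (auxiliary). [folklore] -/
theorem es_eventuallyEq {h : ℝ} (hh : h ∈ Ioo (0.15 : ℝ) 0.85) : L.es =ᶠ[𝓝 h] L.e := by
  filter_upwards [Ioo_mem_nhds hh.1 hh.2] with u hu
  exact L.es_of_mem (Ioo_subset_Icc_self hu)

/-- `hasDerivAt_e` (auxiliary). [folklore] -/
theorem hasDerivAt_e {h : ℝ} (hh : h ∈ Ioo (0.15 : ℝ) 0.85) : HasDerivAt L.e (deriv L.e h) h :=
  ((L.e_smooth.differentiableOn (by simp)).differentiableAt
    (Ioo_mem_nhds (by linarith [hh.1]) (by linarith [hh.2]))).hasDerivAt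

/-- **The slope of the lower rise radius on the blend zone**:
`r_lo' = -ρt' e + (1 - ρt) e'`, with `-s_max ≤ r_lo' ≤ -λ`. [folklore] -/
theorem hasDerivAt_rlo_zone {h : ℝ} (hh : h ∈ Icc L.hD (L.hD + L.β)) :
    HasDerivAt L.rlo (-deriv L.dl.ρt h * L.e h + (1 - L.dl.ρt h) * deriv L.e h) h := by
  have hw := L.zone_sub_win hh
  have hρ : HasDerivAt L.ρlo (deriv L.dl.ρt h) h :=
    ((L.dl.contDiff_ρt.differentiable (by simp) h).hasDerivAt).congr_of_eventuallyEq (L.ρlo_eventuallyEq hh)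
  have he : HasDerivAt L.es (deriv L.e h) h := (L.hasDerivAt_e hw).congr_of_eventuallyEq (L.es_eventuallyEq hw)
  have h1 := ((hρ.const_sub 1).mul he).const_add 1
  have eρ : L.ρlo h = L.dl.ρt h := (L.ρlo_eventuallyEq hh).eq_of_nhds
  have ee : L.es h = L.e h := (L.es_eventuallyEq hw).eq_of_nhds
  refine (h1.congr_of_eventuallyEq (Eventually.of_forall fun u ↦ rfl)).congr_deriv ?_
  rw [eρ, ee]

/-- `deriv_rlo_le_zone` (auxiliary). [folklore] -/
theorem deriv_rlo_le_zone {h : ℝ} (hh : h ∈ Icc L.hD (L.hD + L.β)) : deriv L.rlo h ≤ -L.lam := by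
  rw [(L.hasDerivAt_rlo_zone hh).deriv]
  have hw := L.zone_sub_win hh
  have hρ' := L.deriv_ρt_ge hh
  have hρ := L.ρt_mem_zone hh
  have he := L.e_ge h ⟨by linarith [hw.1], by linarith [hw.2]⟩
  have he' := abs_le.1 (L.e_deriv h hw)
  have hlam := L.lam_le
  have hv : 0 < L.dl.vmin / L.dl.MH := div_pos L.dl.vmin_pos L.dl.MH_pos
  have h1 : L.dl.vmin / L.dl.MH * L.emin ≤ deriv L.dl.ρt h * L.e h := mul_le_mul hρ' he L.emin_pos.le (hv.le.trans hρ')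
  have h2 : (1 - L.dl.ρt h) * deriv L.e h ≤ L.dl.κD * L.Me := by
    have h1ρ : 0 ≤ 1 - L.dl.ρt h := by linarith [hρ.2, L.dl.κD_pos]
    have h1ρ' : 1 - L.dl.ρt h ≤ L.dl.κD := by rw [K2LiteData.xD] at hρ; linarith [hρ.1]
    calc (1 - L.dl.ρt h) * deriv L.e h ≤ (1 - L.dl.ρt h) * L.Me := mul_le_mul_of_nonneg_left he'.2 h1ρ
      _ ≤ L.dl.κD * L.Me := mul_le_mul_of_nonneg_right h1ρ' L.Me_nonneg
  have e3 : L.dl.vmin * L.emin / L.dl.MH = L.dl.vmin / L.dl.MH * L.emin := by ring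
  rw [e3] at hlam
  linarith

/-- `deriv_rlo_ge_zone` (auxiliary). [folklore] -/
theorem deriv_rlo_ge_zone {h : ℝ} (hh : h ∈ Icc L.hD (L.hD + L.β)) : -L.smax ≤ deriv L.rlo h := by
  rw [(L.hasDerivAt_rlo_zone hh).deriv, smax]
  have hw := L.zone_sub_win hh
  have hρ'le := L.ρt_deriv_le h
  have hρ'0 := L.dl.deriv_ρt_nonneg h
  have hρ := L.ρt_mem_zone hh
  have he := L.e_le h ⟨by linarith [hw.1], by linarith [hw.2]⟩
  have he0 : 0 ≤ L.e h := (L.emin_pos.le.trans (L.e_ge h ⟨by linarith [hw.1], by linarith [hw.2]⟩))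
  have he' := abs_le.1 (L.e_deriv h hw)
  have h1 : deriv L.dl.ρt h * L.e h ≤ L.Mρ * L.emax := mul_le_mul hρ'le he he0 L.Mρ_pos.le
  have h2 : -(L.dl.κD * L.Me) ≤ (1 - L.dl.ρt h) * deriv L.e h := by
    have h1ρ : 0 ≤ 1 - L.dl.ρt h := by linarith [hρ.2, L.dl.κD_pos]
    have h1ρ' : 1 - L.dl.ρt h ≤ L.dl.κD := by rw [K2LiteData.xD] at hρ; linarith [hρ.1]
    have : -( (1 - L.dl.ρt h) * L.Me) ≤ (1 - L.dl.ρt h) * deriv L.e h := by nlinarith [he'.1]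
    nlinarith [L.Me_nonneg]
  nlinarith [L.κD_le_one, L.Me_nonneg]

/-- **On the blend zone the rise radius stays above the gentle line** (and below the tip radius). [folklore] -/
theorem rm_le_rlo_zone {h : ℝ} (hh : h ∈ Icc L.hD (L.hD + L.β)) : L.rm h ≤ L.rlo h ∧ L.rlo h ≤ L.rD := by
  -- `u ↦ rlo u + smax u` is non-decreasing and `u ↦ rlo u` non-increasing on the zone
  have hI : ∀ u ∈ Icc L.hD h, u ∈ Icc L.hD (L.hD + L.β) := fun u hu ↦ ⟨hu.1, hu.2.trans hh.2⟩
  have hd : ∀ u ∈ Icc L.hD h, HasDerivAt L.rlo (deriv L.rlo u) u := fun u _ ↦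
    (L.contDiff_rlo.differentiable (by simp) u).hasDerivAt
  have hmono : MonotoneOn (fun u ↦ L.rlo u + L.smax * u) (Icc L.hD h) := by
    refine monotoneOn_of_deriv_nonneg (convex_Icc _ _)
      ((L.contDiff_rlo.continuous.add (continuous_const.mul continuous_id)).continuousOn)
      (((L.contDiff_rlo.differentiable (by simp)).add ((differentiable_const _).mul differentiable_id)).differentiableOn)
      fun u hu ↦ ?_
    rw [interior_Icc] at hu
    have h' : HasDerivAt (fun u ↦ L.rlo u + L.smax * u) (deriv L.rlo u + L.smax * 1) u :=
      (hd u (Ioo_subset_Icc_self hu)).add ((hasDerivAt_id u).const_mul _)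
    rw [h'.deriv]; linarith [L.deriv_rlo_ge_zone (hI u (Ioo_subset_Icc_self hu))]
  have hanti : AntitoneOn L.rlo (Icc L.hD h) := by
    refine antitoneOn_of_deriv_nonpos (convex_Icc _ _) L.contDiff_rlo.continuous.continuousOn
      ((L.contDiff_rlo.differentiable (by simp)).differentiableOn) fun u hu ↦ ?_
    rw [interior_Icc] at hu
    linarith [L.deriv_rlo_le_zone (hI u (Ioo_subset_Icc_self hu)), L.lam_pos]
  have h1 := hmono ⟨le_rfl, hh.1⟩ ⟨hh.1, le_rfl⟩ hh.1
  have h2 := hanti ⟨le_rfl, hh.1⟩ ⟨hh.1, le_rfl⟩ hh.1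
  simp only at h1
  rw [L.rlo_hD] at h1 h2
  refine ⟨?_, h2⟩
  rw [rm]
  nlinarith [L.smax_pos, hh.1, hh.2, L.lam_pos, mul_nonneg L.lam_pos.le (sub_nonneg.2 hh.1)]

/-! ### The slope of the blend and of the clamped blend -/

/-- The derivative of the lower blend. [folklore] -/
theorem hasDerivAt_Bl (h : ℝ) :
    HasDerivAt L.Bl ((1 - L.T h) * deriv L.rlo h + L.T h * (-L.lam) +
      deriv (smoothStep L.hD (L.hD + L.β)) h * (L.rm h - L.rlo h)) h := by
  have hT : HasDerivAt L.T (deriv (smoothStep L.hD (L.hD + L.β)) h) h :=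
    ((contDiff_smoothStep _ _).differentiable (by simp) h).hasDerivAt
  have hr : HasDerivAt L.rlo (deriv L.rlo h) h := (L.contDiff_rlo.differentiable (by simp) h).hasDerivAt
  have hm : HasDerivAt L.rm (0 - L.lam * 1) h := by
    have := ((hasDerivAt_id h).sub_const L.hD).const_mul L.lam
    exact (hasDerivAt_const h _).sub (by simpa using this)
  have h1 := ((hT.const_sub 1).mul hr).add (hT.mul hm)
  refine (h1.congr_of_eventuallyEq (Eventually.of_forall fun u ↦ rfl)).congr_deriv ?_
  simp only [K1LoopData.T]; ring

/-- **Beyond the tip the blend descends at rate at least `λ`.** [folklore] -/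
theorem deriv_Bl_le {h : ℝ} (hh : L.hD ≤ h) : deriv L.Bl h ≤ -L.lam := by
  rw [(L.hasDerivAt_Bl h).deriv]
  have hT := L.T_mem h
  have hT' : 0 ≤ deriv (smoothStep L.hD (L.hD + L.β)) h := deriv_smoothStep_nonneg L.T_lt h
  rcases le_or_gt h (L.hD + L.β) with h1 | h1
  · have hz : h ∈ Icc L.hD (L.hD + L.β) := ⟨hh, h1⟩
    have hr := L.deriv_rlo_le_zone hz
    have hrm := (L.rm_le_rlo_zone hz).1
    nlinarith [mul_le_mul_of_nonneg_left hr (by linarith [hT.2] : (0:ℝ) ≤ 1 - L.T h),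
      mul_nonpos_of_nonneg_of_nonpos hT' (sub_nonpos.2 hrm)]
  · rw [K1LoopData.T, smoothStep_of_ge L.T_lt h1.le, deriv_smoothStep_of_gt L.T_lt h1]; ring_nf; rfl

/-- Beyond the blend zone the blend is the gentle line: slope exactly `-λ`. [folklore] -/
theorem deriv_Bl_of_ge {h : ℝ} (hh : L.hD + L.β ≤ h) : deriv L.Bl h = -L.lam := by
  rw [(L.hasDerivAt_Bl h).deriv, K1LoopData.T, smoothStep_of_ge L.T_lt hh]
  rcases hh.eq_or_lt with h1 | h1
  · rw [← h1, deriv_smoothStep_right L.T_lt]; ring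
  · rw [deriv_smoothStep_of_gt L.T_lt h1]; ring

/-- Beyond the tip the blend is at most the tip radius. [folklore] -/
theorem Bl_le_rD {h : ℝ} (hh : L.hD ≤ h) : L.Bl h ≤ L.rD := by
  rcases le_or_gt h (L.hD + L.β) with h1 | h1
  · have hz := L.rm_le_rlo_zone ⟨hh, h1⟩
    have hT := L.T_mem h
    rw [Bl]; nlinarith [hz.1, hz.2, hT.1, hT.2]
  · rw [L.Bl_of_ge h1.le, rm]
    nlinarith [L.smax_pos, L.β_pos, L.lam_pos, mul_nonneg L.lam_pos.le (by linarith : (0:ℝ) ≤ h - L.hD)]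

/-- On `[h_D, h_g]` the blend is above the clamp threshold. [folklore] -/
theorem Bl_ge_of_le_hg {h : ℝ} (hh : h ∈ Icc L.hD L.hg) : L.rlow + L.εf ≤ L.Bl h := by
  have hcl : L.rlow + L.εf ≤ L.rm L.hg := by
    have := L.clamp_lo; simp only [rm, rD, smax, K1LoopData.hD] at this ⊢; linarith
  have hrm : L.rm L.hg ≤ L.rm h := by
    rw [rm, rm]; nlinarith [L.lam_pos, hh.2]
  rcases le_or_gt h (L.hD + L.β) with h1 | h1
  · have hz := L.rm_le_rlo_zone ⟨hh.1, h1⟩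
    have hT := L.T_mem h
    rw [Bl]; nlinarith [hz.1, hT.1, hT.2]
  · rw [L.Bl_of_ge h1.le]; linarith

/-- **The derivative of the clamped lower blend.** [folklore] -/
theorem hasDerivAt_rsl (h : ℝ) : HasDerivAt L.rsl (deriv L.cl (L.Bl h) * deriv L.Bl h) h := by
  have hB : HasDerivAt L.Bl (deriv L.Bl h) h := (L.contDiff_Bl.differentiable (by simp) h).hasDerivAt
  have hc : HasDerivAt L.cl (deriv L.cl (L.Bl h)) (L.Bl h) := (L.contDiff_cl.differentiable (by simp) _).hasDerivAt
  exact hc.comp h hB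

/-- **Beyond the tip the fingertip radius is non-increasing.** [folklore] -/
theorem deriv_rsl_nonpos {h : ℝ} (hh : L.hD ≤ h) : deriv L.rsl h ≤ 0 := by
  rw [(L.hasDerivAt_rsl h).deriv]
  exact mul_nonpos_of_nonneg_of_nonpos (L.deriv_cl_mem _).1 (by linarith [L.deriv_Bl_le hh, L.lam_pos])

/-- **On `[h_D, h_g]` the fingertip radius descends at rate at least `λ`.** [folklore] -/
theorem deriv_rsl_le {h : ℝ} (hh : h ∈ Icc L.hD L.hg) : deriv L.rsl h ≤ -L.lam := by
  rw [(L.hasDerivAt_rsl h).deriv, L.deriv_cl_of_ge (L.Bl_ge_of_le_hg hh), one_mul]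
  exact L.deriv_Bl_le hh.1

/-- **Beyond the blend zone the descent is gentle**: `rsl' ≥ -(1 + C_T) λ`. [folklore] -/
theorem deriv_rsl_ge {h : ℝ} (hh : L.hD + L.β ≤ h) : -((1 + L.CT) * L.lam) ≤ deriv L.rsl h := by
  rw [(L.hasDerivAt_rsl h).deriv, L.deriv_Bl_of_ge hh]
  have hc := L.deriv_cl_mem (L.Bl h)
  nlinarith [hc.1, hc.2, L.lam_pos]

/-- On `[h_D, h_g]` the clamp is inactive: `rsl = B`. [folklore] -/
theorem rsl_of_le_hg {h : ℝ} (hh : h ∈ Icc L.hD L.hg) : L.rsl h = L.Bl h := by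
  rw [rsl, L.cl_of_ge (L.Bl_ge_of_le_hg hh)]

/-- `rsl_hD` (auxiliary). [folklore] -/
theorem rsl_hD : L.rsl L.hD = L.rD := by
  have h1 := L.hg_ge; have h2 := L.β_pos
  have hle : L.hD ≤ L.hg := by simp only [K1LoopData.hD]; linarith
  rw [L.rsl_of_le_hg ⟨le_rfl, hle⟩, L.Bl_of_le_hD le_rfl, L.rlo_hD]

/-- **Beyond the tip the fingertip radius lies in `[r_low, r_D]`.** [folklore] -/
theorem rsl_mem {h : ℝ} (hh : L.hD ≤ h) : L.rsl h ∈ Icc L.rlow L.rD := by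
  refine ⟨L.rlow_le_cl _, (L.cl_le_max _).trans (max_le (L.Bl_le_rD hh) ?_)⟩
  linarith [L.rlow_add_le_rD, L.εf_pos]

/-! ### Values of the profile -/

/-- `Bl_le_one_add_es` (auxiliary). [folklore] -/
theorem Bl_le_one_add_es (h : ℝ) : L.Bl h ≤ 1 + L.es h := by
  rcases le_or_gt h L.hD with h1 | h1
  · rw [L.Bl_of_le_hD h1, rlo]
    nlinarith [(L.ρlo_mem h).1, L.es_pos h]
  · have := L.Bl_le_rD h1.le
    have hrD : L.rD ≤ 1 + L.emin := by
      rw [L.rD_eq]; nlinarith [L.κD_e, (L.es_mem L.hD).2, L.dl.κD_pos]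
    linarith [(L.es_mem h).1]

/-- `Bu_le_one_add_es` (auxiliary). [folklore] -/
theorem Bu_le_one_add_es (h : ℝ) : L.Bu h ≤ 1 + L.es h := by
  rcases le_or_gt L.hDu h with h1 | h1
  · rw [L.Bu_of_ge_hDu h1, rup]
    nlinarith [(L.ρup_mem h).1, L.es_pos h]
  · -- below the upper tip: `Bu ≤ max (rup, rmu) ≤ ...`; we only need the bound via the clamp structure:
    -- `Bu = Tu rup + (1 - Tu) rmu` with `rmu h ≤ rDu ≤ 1 + emin` and `rup h ≤ 1 + es h`
    have hT := L.Tu_mem h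
    have hrup : L.rup h ≤ 1 + L.es h := by rw [rup]; nlinarith [(L.ρup_mem h).1, L.es_pos h]
    have hrmu : L.rmu h ≤ 1 + L.es h := by
      have hrDu : L.rDu ≤ 1 + L.emin := by
        rw [L.rDu_eq]; nlinarith [L.κD_e', (L.es_mem L.hDu).2, L.du.κD_pos]
      rw [rmu]
      nlinarith [L.smax_pos, L.β_pos, L.lam_pos, (L.es_mem h).1, mul_nonneg L.lam_pos.le (by linarith : (0:ℝ) ≤ L.hDu - h)]
    rw [Bu]; nlinarith [hT.1, hT.2]

/-- `rlow_le_one_add_es` (auxiliary). [folklore] -/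
theorem rlow_le_one_add_es (h : ℝ) : L.rlow ≤ 1 + L.es h := by
  have h1 := L.rlow_add_le_rD
  have hrD : L.rD ≤ 1 + L.emin := by
    rw [L.rD_eq]; nlinarith [L.κD_e, (L.es_mem L.hD).2, L.dl.κD_pos]
  linarith [(L.es_mem h).1, L.εf_pos]

/-- **The fingertip radius lies in `[r_low, 1 + e]`.** [folklore] -/
theorem rstar_mem (h : ℝ) : L.rlow ≤ L.rstar h ∧ L.rstar h ≤ 1 + L.es h := by
  rcases le_or_gt h L.hclu with h1 | h1
  · rw [L.rstar_of_le_hclu h1]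
    exact ⟨L.rlow_le_cl _, (L.cl_le_max _).trans (max_le (L.Bl_le_one_add_es h) (L.rlow_le_one_add_es h))⟩
  · rw [L.rstar_of_ge_hcl (L.hcl_le_hclu.trans h1.le)]
    exact ⟨L.rlow_le_cl _, (L.cl_le_max _).trans (max_le (L.Bu_le_one_add_es h) (L.rlow_le_one_add_es h))⟩

/-- **The profile takes values in `[0, 1)`.** [folklore] -/
theorem rho2_mem (h : ℝ) : L.rho2 h ∈ Ico (0 : ℝ) 1 := by
  have hr := L.rstar_mem h
  have he := L.es_pos h
  have hgt := L.rlow_gt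
  rw [rho2]
  constructor
  · rw [sub_nonneg, div_le_one he]; linarith [hr.2]
  · have : 0 < (L.rstar h - 1) / L.es h := div_pos (by linarith [hr.1]) he
    linarith

/-- `rho2_mem_Icc` (auxiliary). [folklore] -/
theorem rho2_mem_Icc (h : ℝ) : L.rho2 h ∈ Icc (0 : ℝ) 1 := ⟨(L.rho2_mem h).1, (L.rho2_mem h).2.le⟩

/-- **The slice radius of the profile is `rstar`**: `1 + (1 - rho2 h) e h = rstar h` on the window. [folklore] -/
theorem radius_rho2 {h : ℝ} (hh : h ∈ Icc (0.15 : ℝ) 0.85) : 1 + (1 - L.rho2 h) * L.e h = L.rstar h := by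
  rw [rho2, ← L.es_of_mem hh]
  field_simp [(L.es_pos h).ne']
  ring

end K1Loop2Data

end Literature.Topology.FourManifolds
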